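import Mathlib

/-!
# The Gram pencil lemma (stub `stub_plainConfinementTransc` of crux `HcpDiffractionRigidity`,
# item `stmt-AtomisticToContinuum-13166`, Aux file: pure linear algebra)

Let `uᵢ` (`i ∈ ι`, finite) be vectors of a real inner product space whose Gram matrix is
`a² (P + t Q)` with `P, Q` rational symmetric matrices, `a ≠ 0` and `t` transcendental.
**Pencil lemma** (`linearIndependent_of_rat`, registered as `stub_plainConfinementTranscPencil`):
if the `uᵢ` are `ℚ`-linearly independent, they are `ℝ`-linearly independent.

Proof.  A real dependence makes `det (P + t Q) = 0`; the matrix `P + t Q` has entries in the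
domain `ℚ[t] ⊆ ℝ`, so it has a non-zero kernel vector with entries `cᵢ = fᵢ(t)`, `fᵢ ∈ ℚ[X]`.
Since `t` is transcendental, `∑ᵢ (P + X Q)ⱼᵢ fᵢ = 0` in `ℚ[X]`; comparing coefficients, the
coefficient vectors `x_k = (coeff_k fᵢ)ᵢ ∈ ℚ^ι` satisfy `P x₀ = 0`, `P x_{k+1} + Q x_k = 0`.
**Hankel lemma** (`hankel_fst`, `hankel_snd`): for symmetric `P, Q` these relations force
`x_kᵀ P x_j = 0 = x_kᵀ Q x_j` for all `k, j` (the numbers `x_kᵀ P x_j` are constant along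
anti-diagonals and vanish for `j = 0`).  Hence `‖∑ᵢ x_{k,i} uᵢ‖² = a² x_kᵀ (P + t Q) x_k = 0`, so
every `x_k` vanishes by `ℚ`-independence, all `fᵢ = 0`, `c = 0`: contradiction.

Also: bounded denominators of the image of integer vectors under a `ℚ`-linear map
(`exists_denom`), the extension of a two-component Gram integrality from generators to their
`ℤ`-span (`gram_span`), and rational Gram data (`exists_rat_gram`).  All `[folklore]`.
-/

noncomputable section

namespace Summit.AtomisticToContinuum.Crystallization.Theorems

namespace HcpRigidityPencil

open Module Submodule Polynomial
open scoped BigOperators RealInnerProductSpace Matrix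

/-! ## Rational bookkeeping -/

/-- A transcendental real number is irrational. [folklore] -/
theorem irrational_of_transcendental {t : ℝ} (ht : Transcendental ℚ t) : Irrational t := by
  rintro ⟨q, rfl⟩
  exact ht (isAlgebraic_algebraMap q)

/-- **Uniqueness of the `(1, t)`-decomposition** for irrational `t`: `p₁ + t q₁ = p₂ + t q₂`
with rational `pᵢ, qᵢ` forces `p₁ = p₂` and `q₁ = q₂`. [folklore] -/
theorem coeff_unique {t : ℝ} (ht : Irrational t) {p₁ q₁ p₂ q₂ : ℚ}
    (h : (p₁ : ℝ) + t * q₁ = p₂ + t * q₂) : p₁ = p₂ ∧ q₁ = q₂ := by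
  by_cases hq : q₁ = q₂
  · subst hq
    refine ⟨?_, rfl⟩
    have h1 : (p₁ : ℝ) = p₂ := by linarith
    exact_mod_cast h1
  · exfalso
    refine ht.ne_rat ((p₂ - p₁) / (q₁ - q₂)) ?_
    have hq' : (q₁ : ℝ) - q₂ ≠ 0 := by exact_mod_cast sub_ne_zero.2 hq
    push_cast
    field_simp
    linear_combination h

/-! ## The Hankel lemma -/

section Hankel

variable {R : Type*} [CommRing R] {ι : Type*} [Fintype ι]

/-- For a symmetric matrix `M`, `vᵀ M w = wᵀ M v`. [folklore] -/
theorem dotProduct_mulVec_comm_of_isSymm {M : Matrix ι ι R} (hM : M.IsSymm) (v w : ι → R) :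
    v ⬝ᵥ M *ᵥ w = w ⬝ᵥ M *ᵥ v := by
  rw [Matrix.dotProduct_mulVec, ← Matrix.mulVec_transpose, hM.eq, dotProduct_comm]

/-- **Hankel lemma, first form.** If `P, Q` are symmetric, `P x₀ = 0` and
`P x_{k+1} + Q x_k = 0` for all `k`, then `x_kᵀ P x_j = 0` for all `k, j`. [folklore] -/
theorem hankel_fst {P Q : Matrix ι ι R} (hP : P.IsSymm) (hQ : Q.IsSymm) {x : ℕ → ι → R}
    (h0 : P *ᵥ x 0 = 0) (hsucc : ∀ k, P *ᵥ x (k + 1) + Q *ᵥ x k = 0) (k j : ℕ) :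
    x k ⬝ᵥ P *ᵥ x j = 0 := by
  have hP' : ∀ k, P *ᵥ x (k + 1) = -(Q *ᵥ x k) := fun k => eq_neg_of_add_eq_zero_left (hsucc k)
  induction j generalizing k with
  | zero => rw [h0, dotProduct_zero]
  | succ j ih =>
    rw [hP', dotProduct_neg, dotProduct_mulVec_comm_of_isSymm hQ, ← dotProduct_neg, ← hP',
      dotProduct_mulVec_comm_of_isSymm hP, ih]

/-- **Hankel lemma, second form.** Under the hypotheses of `hankel_fst` also `x_kᵀ Q x_j = 0`
for all `k, j`. [folklore] -/
theorem hankel_snd {P Q : Matrix ι ι R} (hP : P.IsSymm) (hQ : Q.IsSymm) {x : ℕ → ι → R}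
    (h0 : P *ᵥ x 0 = 0) (hsucc : ∀ k, P *ᵥ x (k + 1) + Q *ᵥ x k = 0) (k j : ℕ) :
    x k ⬝ᵥ Q *ᵥ x j = 0 := by
  have hP' : ∀ k, P *ᵥ x (k + 1) = -(Q *ᵥ x k) := fun k => eq_neg_of_add_eq_zero_left (hsucc k)
  rw [← neg_eq_zero, ← dotProduct_neg, ← hP', hankel_fst hP hQ h0 hsucc]

end Hankel

/-! ## The pencil lemma -/

section Symm

variable {E : Type*} [NormedAddCommGroup E] [InnerProductSpace ℝ E] {ι : Type*}

/-- The rational matrices of a Gram decomposition `⟪uᵢ, uⱼ⟫ = a² (Pᵢⱼ + t Qᵢⱼ)` (`a ≠ 0`,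
`t` irrational) are symmetric. [folklore] -/
theorem isSymm_of_gram {u : ι → E} {a t : ℝ} (ha : a ≠ 0) (ht : Irrational t)
    {P Q : Matrix ι ι ℚ} (hG : ∀ i j, ⟪u i, u j⟫ = a ^ 2 * ((P i j : ℝ) + t * (Q i j : ℝ))) :
    P.IsSymm ∧ Q.IsSymm := by
  have key : ∀ i j, P j i = P i j ∧ Q j i = Q i j := by
    intro i j
    have h1 := hG i j
    rw [real_inner_comm, hG j i] at h1
    exact coeff_unique ht (mul_left_cancel₀ (pow_ne_zero 2 ha) h1)
  exact ⟨Matrix.IsSymm.ext fun i j => (key i j).1, Matrix.IsSymm.ext fun i j => (key i j).2⟩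

end Symm

section Pencil

variable {E : Type*} [NormedAddCommGroup E] [InnerProductSpace ℝ E]
variable {ι : Type*} [Fintype ι]

/-- Gram expansion of two rational combinations of a family with Gram matrix `a² (P + t Q)`.
[folklore] -/
theorem inner_sum_smul_sum_smul {u : ι → E} {a t : ℝ} {P Q : Matrix ι ι ℚ}
    (hG : ∀ i j, ⟪u i, u j⟫ = a ^ 2 * ((P i j : ℝ) + t * (Q i j : ℝ))) (c d : ι → ℚ) :
    ⟪∑ i, ((c i : ℚ) : ℝ) • u i, ∑ j, ((d j : ℚ) : ℝ) • u j⟫ =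
      a ^ 2 * (((c ⬝ᵥ P *ᵥ d : ℚ) : ℝ) + t * ((c ⬝ᵥ Q *ᵥ d : ℚ) : ℝ)) := by
  calc ⟪∑ i, ((c i : ℚ) : ℝ) • u i, ∑ j, ((d j : ℚ) : ℝ) • u j⟫
      = ∑ i, ∑ j, (c i : ℝ) * (d j : ℝ) * (a ^ 2 * ((P i j : ℝ) + t * (Q i j : ℝ))) := by
        rw [sum_inner]
        refine Finset.sum_congr rfl fun i _ => ?_
        rw [real_inner_smul_left, inner_sum, Finset.mul_sum]
        refine Finset.sum_congr rfl fun j _ => ?_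
        rw [real_inner_smul_right, hG]
        ring
    _ = a ^ 2 * (((c ⬝ᵥ P *ᵥ d : ℚ) : ℝ) + t * ((c ⬝ᵥ Q *ᵥ d : ℚ) : ℝ)) := by
        push_cast [dotProduct, Matrix.mulVec]
        simp only [Finset.mul_sum, mul_add, Finset.sum_add_distrib]
        congr 1 <;> exact Finset.sum_congr rfl fun i _ => Finset.sum_congr rfl fun j _ => by ring

/-- Gram expansion of a rational combination against a member of the family. [folklore] -/
theorem inner_sum_smul_left {u : ι → E} {a t : ℝ} {P Q : Matrix ι ι ℚ}
    (hG : ∀ i j, ⟪u i, u j⟫ = a ^ 2 * ((P i j : ℝ) + t * (Q i j : ℝ))) (c : ι → ℚ) (j : ι) :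
    ⟪∑ i, ((c i : ℚ) : ℝ) • u i, u j⟫ =
      a ^ 2 * ((((c ᵥ* P) j : ℚ) : ℝ) + t * (((c ᵥ* Q) j : ℚ) : ℝ)) := by
  simp only [sum_inner, real_inner_smul_left, hG]
  push_cast [Matrix.vecMul, dotProduct]
  simp only [Finset.mul_sum, mul_add, Finset.sum_add_distrib]
  congr 1 <;> exact Finset.sum_congr rfl fun i _ => by ring

variable [DecidableEq ι]

/-- **The Gram pencil lemma.** Let `uᵢ` (`i ∈ ι`) have Gram matrix `a² (P + t Q)` with `P, Q`
rational symmetric, `a ≠ 0`, `t` transcendental. If the `uᵢ` are `ℚ`-linearly independent, they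
are `ℝ`-linearly independent. [folklore] -/
theorem linearIndependent_of_rat {u : ι → E} {a t : ℝ} (ha : a ≠ 0) (ht : Transcendental ℚ t)
    {P Q : Matrix ι ι ℚ} (hP : P.IsSymm) (hQ : Q.IsSymm)
    (hG : ∀ i j, ⟪u i, u j⟫ = a ^ 2 * ((P i j : ℝ) + t * (Q i j : ℝ)))
    (hu : ∀ c : ι → ℚ, ∑ i, ((c i : ℚ) : ℝ) • u i = 0 → c = 0) : LinearIndependent ℝ u := by
  classical
  by_contra hli
  obtain ⟨g, hg, i₀, hi₀⟩ := Fintype.not_linearIndependent_iff.1 hli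
  have ha2 : a ^ 2 ≠ 0 := pow_ne_zero 2 ha
  -- the real matrix `P + t Q` is singular
  set M : Matrix ι ι ℝ := Matrix.of fun i j => (P i j : ℝ) + t * (Q i j : ℝ) with hM_def
  have hMg : M *ᵥ g = 0 := by
    funext j
    have h1 : ⟪u j, ∑ i, g i • u i⟫ = 0 := by rw [hg, inner_zero_right]
    simp only [inner_sum, real_inner_smul_right, hG] at h1
    have h2 : a ^ 2 * (M *ᵥ g) j = 0 := by
      rw [← h1, Matrix.mulVec, dotProduct, Finset.mul_sum]
      exact Finset.sum_congr rfl fun i _ => by rw [hM_def, Matrix.of_apply]; ring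
    simpa [ha2] using h2
  have hdetR : M.det = 0 :=
    Matrix.exists_mulVec_eq_zero_iff.1 ⟨g, fun h => hi₀ (congr_fun h i₀), hMg⟩
  -- descend to the domain `ℚ[t]`
  set A : Subalgebra ℚ ℝ := Algebra.adjoin ℚ {t} with hA_def
  have htA : t ∈ A := Algebra.self_mem_adjoin_singleton ℚ t
  have hratA : ∀ q : ℚ, (q : ℝ) ∈ A := fun q => by simpa using A.algebraMap_mem q
  have hmem : ∀ i j, (P i j : ℝ) + t * (Q i j : ℝ) ∈ A := fun i j =>
    add_mem (hratA _) (mul_mem htA (hratA _))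
  set MA : Matrix ι ι A := Matrix.of fun i j => ⟨_, hmem i j⟩ with hMA_def
  have hmap : (algebraMap A ℝ).mapMatrix MA = M := by
    ext i j
    rfl
  have hdetA : MA.det = 0 := by
    have h1 := RingHom.map_det (algebraMap A ℝ) MA
    rw [hmap, hdetR] at h1
    exact Subtype.ext h1
  obtain ⟨c, hc0, hc⟩ := Matrix.exists_mulVec_eq_zero_iff.2 hdetA
  -- the kernel vector has polynomial entries
  have hpoly : ∀ i, ∃ f : ℚ[X], aeval t f = (c i : ℝ) := fun i => by
    have h1 : (c i : ℝ) ∈ Algebra.adjoin ℚ {t} := (c i).2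
    rw [Algebra.adjoin_singleton_eq_range_aeval] at h1
    exact (AlgHom.mem_range _).1 h1
  choose f hf using hpoly
  have hrel : ∀ j, ∑ i, ((P j i : ℝ) + t * (Q j i : ℝ)) * (c i : ℝ) = 0 := fun j => by
    have h1 := congrArg (algebraMap A ℝ) (congr_fun hc j)
    rw [Pi.zero_apply, map_zero, Matrix.mulVec, dotProduct, map_sum] at h1
    rw [← h1]
    exact Finset.sum_congr rfl fun i _ => by rw [map_mul]; rfl
  -- the polynomial relations `∑ᵢ (P + X Q)ⱼᵢ fᵢ = 0`
  set F : ι → ℚ[X] := fun j => ∑ i, (C (P j i) * f i + C (Q j i) * (X * f i)) with hF_def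
  have hF : ∀ j, F j = 0 := by
    intro j
    by_contra hne
    refine ht ⟨F j, hne, ?_⟩
    rw [← hrel j]
    simp only [hF_def, map_sum, map_add, map_mul, aeval_C, aeval_X, hf, eq_ratCast]
    exact Finset.sum_congr rfl fun i _ => by ring
  -- coefficient vectors
  set x : ℕ → ι → ℚ := fun k i => (f i).coeff k with hx_def
  have h0 : P *ᵥ x 0 = 0 := by
    funext j
    have h1 := congrArg (fun p : ℚ[X] => p.coeff 0) (hF j)
    simp only [hF_def, finsetSum_coeff, coeff_add, coeff_C_mul, coeff_X_mul_zero, coeff_zero,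
      mul_zero, add_zero] at h1
    simpa [Matrix.mulVec, dotProduct, hx_def] using h1
  have hsucc : ∀ k, P *ᵥ x (k + 1) + Q *ᵥ x k = 0 := by
    intro k
    funext j
    have h1 := congrArg (fun p : ℚ[X] => p.coeff (k + 1)) (hF j)
    simp only [hF_def, finsetSum_coeff, coeff_add, coeff_C_mul, coeff_X_mul, coeff_zero,
      Finset.sum_add_distrib] at h1
    simpa [Matrix.mulVec, dotProduct, hx_def] using h1
  -- every coefficient vector vanishes
  have hxk : ∀ k, x k = 0 := by
    intro k
    apply hu
    rw [← inner_self_eq_zero (𝕜 := ℝ), inner_sum_smul_sum_smul hG,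
      hankel_fst hP hQ h0 hsucc k k, hankel_snd hP hQ h0 hsucc k k]
    simp
  have hf0 : ∀ i, f i = 0 := fun i => Polynomial.ext fun k => congr_fun (hxk k) i
  apply hc0
  funext i
  have h1 : (c i : ℝ) = 0 := by rw [← hf i, hf0, map_zero]
  exact_mod_cast h1

end Pencil

/-! ## Denominators and `ℤ`-spans -/

/-- **Bounded denominators.** The image of the integer vectors under a `ℚ`-linear map between
coordinate spaces has a common denominator. [folklore] -/
theorem exists_denom {σ κ : Type*} [Fintype σ] [DecidableEq σ] (Ψ : (σ → ℚ) →ₗ[ℚ] (κ → ℚ))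
    (i : κ) : ∃ D : ℕ, 0 < D ∧ ∀ v : σ → ℚ, (∀ s, ∃ z : ℤ, v s = z) →
      ∃ m : ℤ, (D : ℚ) * Ψ v i = m := by
  obtain ⟨e, he⟩ : ∃ e : σ → σ → ℚ, e = fun s j => if s = j then 1 else 0 := ⟨_, rfl⟩
  have hexp : ∀ v, Ψ v = ∑ s, v s • Ψ (e s) := fun v => by
    rw [he]
    exact LinearMap.pi_apply_eq_sum_univ Ψ v
  refine ⟨∏ s, (Ψ (e s) i).den, Finset.prod_pos fun s _ => Rat.den_pos _, fun v hv => ?_⟩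
  choose z hz using hv
  have hden : ∀ s, ∃ m : ℤ, ((∏ s, (Ψ (e s) i).den : ℕ) : ℚ) * Ψ (e s) i = m := by
    intro s
    obtain ⟨k, hk⟩ : (Ψ (e s) i).den ∣ ∏ s, (Ψ (e s) i).den :=
      Finset.dvd_prod_of_mem _ (Finset.mem_univ s)
    refine ⟨k * (Ψ (e s) i).num, ?_⟩
    rw [hk]
    push_cast
    rw [← Rat.den_mul_eq_num (Ψ (e s) i)]
    ring
  choose m hm using hden
  refine ⟨∑ s, z s * m s, ?_⟩
  rw [hexp v, Finset.sum_apply, Finset.mul_sum, Int.cast_sum]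
  refine Finset.sum_congr rfl fun s _ => ?_
  rw [Pi.smul_apply, smul_eq_mul, hz s, Int.cast_mul, ← hm s]
  ring

section Span

variable {E : Type*} [NormedAddCommGroup E] [InnerProductSpace ℝ E]

/-- **Two-component Gram integrality extends to the `ℤ`-span.** If `D ⟪x, y⟫ ∈ a² (ℤ + t ℤ)`
for `x, y` in a set `T`, then the same holds on the `ℤ`-span of `T`. [folklore] -/
theorem gram_span {T : Set E} {D a t : ℝ}
    (hT : ∀ x ∈ T, ∀ y ∈ T, ∃ m n : ℤ, D * ⟪x, y⟫ = a ^ 2 * (m + t * n)) :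
    ∀ u ∈ span ℤ T, ∀ v ∈ span ℤ T, ∃ m n : ℤ, D * ⟪u, v⟫ = a ^ 2 * (m + t * n) := by
  intro u hu
  induction hu using Submodule.span_induction with
  | mem u hu =>
    intro v hv
    induction hv using Submodule.span_induction with
    | mem v hv => exact hT u hu v hv
    | zero => exact ⟨0, 0, by simp⟩
    | add x y _ _ hx hy =>
      obtain ⟨m, n, hmn⟩ := hx
      obtain ⟨m', n', hmn'⟩ := hy
      exact ⟨m + m', n + n', by rw [inner_add_right, mul_add, hmn, hmn']; push_cast; ring⟩
    | smul k x _ hx =>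
      obtain ⟨m, n, hmn⟩ := hx
      refine ⟨k * m, k * n, ?_⟩
      rw [← Int.cast_smul_eq_zsmul ℝ k x, real_inner_smul_right, mul_left_comm, hmn]
      push_cast
      ring
  | zero => exact fun v _ => ⟨0, 0, by simp⟩
  | add x y _ _ hx hy =>
    intro v hv
    obtain ⟨m, n, hmn⟩ := hx v hv
    obtain ⟨m', n', hmn'⟩ := hy v hv
    exact ⟨m + m', n + n', by rw [inner_add_left, mul_add, hmn, hmn']; push_cast; ring⟩
  | smul k x _ hx =>
    intro v hv
    obtain ⟨m, n, hmn⟩ := hx v hv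
    refine ⟨k * m, k * n, ?_⟩
    rw [← Int.cast_smul_eq_zsmul ℝ k x, real_inner_smul_left, mul_left_comm, hmn]
    push_cast
    ring

/-- **Rational Gram data.** If `K ⟪u_k, u_l⟫ ∈ a² (ℤ + t ℤ)` for a family `u`, then
`⟪u_k, u_l⟫ = a² (P_kl + t Q_kl)` with rational matrices `P, Q` having `K P, K Q` integral.
[folklore] -/
theorem exists_rat_gram {κ : Type*} {K : ℕ} (hK : 0 < K) {a t : ℝ} (u : κ → E)
    (h : ∀ k l, ∃ m n : ℤ, (K : ℝ) * ⟪u k, u l⟫ = a ^ 2 * (m + t * n)) :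
    ∃ P Q : Matrix κ κ ℚ, (∀ k l, ∃ m : ℤ, (K : ℚ) * P k l = m) ∧
      (∀ k l, ∃ n : ℤ, (K : ℚ) * Q k l = n) ∧
      ∀ k l, ⟪u k, u l⟫ = a ^ 2 * ((P k l : ℝ) + t * (Q k l : ℝ)) := by
  choose m n hmn using h
  have hK' : (K : ℚ) ≠ 0 := by exact_mod_cast hK.ne'
  have hKR : (K : ℝ) ≠ 0 := by exact_mod_cast hK.ne'
  refine ⟨Matrix.of fun k l => (m k l : ℚ) / K, Matrix.of fun k l => (n k l : ℚ) / K,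
    fun k l => ⟨m k l, ?_⟩, fun k l => ⟨n k l, ?_⟩, fun k l => ?_⟩
  · rw [Matrix.of_apply, mul_div_cancel₀ _ hK']
  · rw [Matrix.of_apply, mul_div_cancel₀ _ hK']
  · rw [Matrix.of_apply, Matrix.of_apply]
    apply mul_left_cancel₀ hKR
    rw [hmn]
    push_cast
    field_simp

end Span

end HcpRigidityPencil

/-- **Registered helper stub of `stub_plainConfinementTransc` (Aux file): the Gram pencil
lemma.** If `u : Fin d → ℝ³` has Gram matrix `a² (P + t Q)` with `P, Q` rational symmetric,
`a ≠ 0`, `t` transcendental, and the `uᵢ` are `ℚ`-linearly independent, then they are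
`ℝ`-linearly independent. [folklore] -/
theorem stub_plainConfinementTranscPencil : ∀ (a t : ℝ) (d : ℕ) (P Q : Matrix (Fin d) (Fin d) ℚ) (u : Fin d → EuclideanSpace ℝ (Fin 3)), a ≠ 0 → Transcendental ℚ t → Matrix.IsSymm P → Matrix.IsSymm Q → (∀ i j : Fin d, inner ℝ (u i) (u j) = a ^ 2 * (((P i j : ℚ) : ℝ) + t * ((Q i j : ℚ) : ℝ))) → (∀ c : Fin d → ℚ, ∑ i : Fin d, ((c i : ℚ) : ℝ) • u i = 0 → c = 0) → LinearIndependent ℝ u :=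
  fun _ _ _ _ _ _ ha ht hP hQ hG hu => HcpRigidityPencil.linearIndependent_of_rat ha ht hP hQ hG hu

end Summit.AtomisticToContinuum.Crystallization.Theorems

end
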